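import Literature.NumberTheory.Sieve.GoldbachLinnikFirstMoment
import Literature.NumberTheory.Sieve.CircleMethod
import HarnessLib

/-!
# Goldbach–Linnik numbers: the generating functions and Parseval (Pintz–Ruzsa I, (10.3))

Topic `Literature/NumberTheory/Sieve`; support file for the named fact
`Literature.NumberTheory.Sieve.goldbach_linnik` (parity.S36). Sequel to
`GoldbachLinnikFirstMoment.lean`.

Pintz–Ruzsa, *On Linnik's approximation to Goldbach's problem, I*, Acta Arith. 109 (2003): the
generating functions `S(α) = ∑_{p ≤ N} e(pα)` (`p` odd primes, (2.4)) and
`G(α) = ∑_{m ≤ L} e(2^m α)` (`1 ≤ m ≤ L = [log₂ N]`, (8.1)–(8.4)), and the first line of the proof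
of Lemma 13, (10.3): "Ignoring the terms with `m > N` we obtain by Parseval's identity
`∑_{m ≤ N} (r'_k(m))² ≤ ∫₀¹ |S(α) G^k(α)|² dα`."

* `primeSum`, `powSum` — `S` and `G`;
* `primeSum_mul_powSum_pow` — `S(α) G(α)^k = ∑_{(p,ν)} e((p + 2^{ν₁} + ⋯ + 2^{ν_k}) α)`;
* `integral_norm_sq_expSum` — Parseval for a finite family of frequencies:
  `∫₀¹ |∑_x e(f(x)α)|² dα = #{(x, y) : f(x) = f(y)}` (orthogonality,
  `Literature.NumberTheory.Sieve.integral_fourierChar_intCast_holds`);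
* `secondMoment_le_integral` — (10.3): `∑_{n<N, 2∤n} r'_k(n)² ≤ ∫₀¹ |S G^k|²`;
* `goldbach_linnik_of_meanSquare_four` — `goldbach_linnik` from the mean-square bound
  `∫₀¹ |S G⁴|² ≤ (1 + B + ε) 2NL⁸/log² N` (`0 ≤ B < 1`) for all large `N`, i.e. from Pintz–Ruzsa's
  Lemma 13 for `k = 4` in the form in which it is proved ((10.3)–(10.6); Part II: `B ≈ 0.95`).

No named facts are introduced.

## References

* J. Pintz, I. Z. Ruzsa, *On Linnik's approximation to Goldbach's problem, I*, Acta Arith. 109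
  (2003) 169–194, (2.4), (8.1)–(8.4), Lemma 13 and (10.3). [PintzRuzsa2003]
* R. C. Vaughan, *The Hardy–Littlewood Method*, 2nd ed. (1997), §1.2 eq. (1.4) (orthogonality).
  [VaughanHL1997]
-/

noncomputable section

open scoped FourierTransform

open Finset Filter MeasureTheory

namespace Literature.NumberTheory.Sieve

namespace GoldbachLinnik

/-! ### The generating functions -/

/-- `S(α) = ∑_{p ≤ N, p odd prime} e(pα)` (Pintz–Ruzsa I (2.4)). [cite: PintzRuzsa2003, (2.4)] -/
def primeSum (N : ℕ) (α : ℝ) : ℂ := ∑ p ∈ oddPrimes N, (𝐞 ((p : ℝ) * α) : ℂ)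

/-- `G(α) = G_L(α) = ∑_{1 ≤ m ≤ L} e(2^m α)`, `L = [log₂ N]` (Pintz–Ruzsa I (8.1)–(8.4)).
[cite: PintzRuzsa2003, (8.4)] -/
def powSum (N : ℕ) (α : ℝ) : ℂ := ∑ m ∈ Icc 1 (powLen N), (𝐞 (((2 ^ m : ℕ) : ℝ) * α) : ℂ)

/-- `e(x + y) = e(x) e(y)` in `ℂ`. [folklore] -/
theorem fourierChar_add_coe (x y : ℝ) : (𝐞 (x + y) : ℂ) = (𝐞 x : ℂ) * 𝐞 y := by
  rw [AddChar.map_add_eq_mul, Circle.coe_mul]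

/-- `e(∑ᵢ xᵢ) = ∏ᵢ e(xᵢ)` in `ℂ`. [folklore] -/
theorem fourierChar_sum_coe {ι : Type*} (s : Finset ι) (x : ι → ℝ) :
    (𝐞 (∑ i ∈ s, x i) : ℂ) = ∏ i ∈ s, (𝐞 (x i) : ℂ) := by
  classical
  induction s using Finset.induction_on with
  | empty => simp
  | insert a s ha ih => rw [Finset.sum_insert ha, Finset.prod_insert ha, fourierChar_add_coe, ih]

/-- `G(α)^k = ∑_{ν ∈ [1,L]^k} e((2^{ν₁} + ⋯ + 2^{ν_k}) α)`. [cite: PintzRuzsa2003, (10.3)] -/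
theorem powSum_pow (N k : ℕ) (α : ℝ) :
    powSum N α ^ k = ∑ ν ∈ expTuples N k, (𝐞 (((∑ i, 2 ^ ν i : ℕ) : ℝ) * α) : ℂ) := by
  rw [← Fin.prod_const k (powSum N α)]
  simp only [powSum]
  rw [Finset.prod_univ_sum]
  refine Finset.sum_congr rfl fun ν _ => ?_
  rw [← fourierChar_sum_coe]
  congr 2
  push_cast
  rw [Finset.sum_mul]

/-- `S(α) G(α)^k = ∑_{(p, ν)} e((p + 2^{ν₁} + ⋯ + 2^{ν_k}) α)`, the sum over odd primes `p ≤ N`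
and `ν ∈ [1, L]^k`; so `S G^k = ∑_n r'_k(n) e(nα)`. [cite: PintzRuzsa2003, (10.3)] -/
theorem primeSum_mul_powSum_pow (N k : ℕ) (α : ℝ) :
    primeSum N α * powSum N α ^ k =
      ∑ x ∈ oddPrimes N ×ˢ expTuples N k, (𝐞 (((x.1 + ∑ i, 2 ^ x.2 i : ℕ) : ℝ) * α) : ℂ) := by
  rw [powSum_pow, primeSum, Finset.sum_mul_sum, Finset.sum_product]
  refine Finset.sum_congr rfl fun p _ => Finset.sum_congr rfl fun ν _ => ?_
  rw [← fourierChar_add_coe]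
  congr 2
  push_cast
  ring

/-! ### Parseval for a finite family of integer frequencies -/

/-- `|∑_x e(f(x)α)|² = ∑_{x,y} e((f(x) - f(y))α)`. [folklore] -/
theorem norm_sq_expSum_eq {β : Type*} (X : Finset β) (f : β → ℕ) (α : ℝ) :
    ((‖∑ x ∈ X, (𝐞 ((f x : ℝ) * α) : ℂ)‖ ^ 2 : ℝ) : ℂ) =
      ∑ x ∈ X, ∑ y ∈ X, (𝐞 ((((f x : ℤ) - f y : ℤ) : ℝ) * α) : ℂ) := by
  rw [← Complex.normSq_eq_norm_sq, ← Complex.mul_conj, map_sum, Finset.sum_mul_sum]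
  refine Finset.sum_congr rfl fun p _ => Finset.sum_congr rfl fun q _ => ?_
  rw [← Circle.coe_inv_eq_conj, ← AddChar.map_neg_eq_inv, ← Circle.coe_mul,
    ← AddChar.map_add_eq_mul]
  congr 2
  push_cast
  ring

/-- **Parseval / coincidence count.** For a finite family of natural-number frequencies,
`∫₀¹ |∑_{x ∈ X} e(f(x)α)|² dα = #{(x, y) ∈ X × X : f(x) = f(y)}`, by orthogonality
`∫₀¹ e(nα) dα = [n = 0]`. [cite: VaughanHL1997, §1.2 eq. (1.4)] -/
theorem integral_norm_sq_expSum {β : Type*} (X : Finset β) (f : β → ℕ) :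
    ∫ α in (0 : ℝ)..1, ‖∑ x ∈ X, (𝐞 ((f x : ℝ) * α) : ℂ)‖ ^ 2 =
      (((X ×ˢ X).filter fun z => f z.1 = f z.2).card : ℝ) := by
  apply Complex.ofReal_injective
  rw [← intervalIntegral.integral_ofReal]
  simp_rw [norm_sq_expSum_eq]
  have hcont : ∀ k : ℤ, Continuous fun α : ℝ => (𝐞 ((k : ℝ) * α) : ℂ) := fun k =>
    continuous_subtype_val.comp
      (Real.continuous_fourierChar.comp (continuous_const.mul continuous_id))
  have horth : ∀ n : ℤ, ∫ α in (0 : ℝ)..1, (𝐞 (n * α) : ℂ) = if n = 0 then 1 else 0 :=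
    integral_fourierChar_intCast_holds
  rw [intervalIntegral.integral_finsetSum fun p _ =>
    (continuous_finsetSum _ fun q _ => hcont _).intervalIntegrable _ _]
  simp_rw [intervalIntegral.integral_finsetSum fun q _ => (hcont _).intervalIntegrable _ _]
  simp_rw [horth, sub_eq_zero, Nat.cast_inj]
  rw [Finset.card_filter, Finset.sum_product]
  push_cast
  exact Finset.sum_congr rfl fun x _ => Finset.sum_congr rfl fun y _ => by split_ifs <;> simp

/-- Summing squared fibre cardinalities over any set of values is bounded by the coincidence
count: `∑_{n ∈ T} #{x : f(x) = n}² ≤ #{(x, y) : f(x) = f(y)}`. [folklore] -/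
theorem sum_card_fiber_sq_le {β : Type*} [DecidableEq β] (X : Finset β) (f : β → ℕ)
    (T : Finset ℕ) :
    ∑ n ∈ T, (X.filter fun x => f x = n).card ^ 2 ≤
      ((X ×ˢ X).filter fun z => f z.1 = f z.2).card := by
  have hdisj : (T : Set ℕ).PairwiseDisjoint fun n =>
      (X.filter fun x => f x = n) ×ˢ (X.filter fun x => f x = n) := by
    intro n _ n' _ hne
    rw [Function.onFun, Finset.disjoint_left]
    rintro ⟨x, y⟩ h h'
    rw [mem_product, mem_filter, mem_filter] at h h'
    exact hne (h.1.2.symm.trans h'.1.2)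
  calc ∑ n ∈ T, (X.filter fun x => f x = n).card ^ 2
      = ∑ n ∈ T, ((X.filter fun x => f x = n) ×ˢ (X.filter fun x => f x = n)).card := by
        simp [sq, card_product]
    _ = (T.biUnion fun n => (X.filter fun x => f x = n) ×ˢ (X.filter fun x => f x = n)).card :=
        (card_biUnion hdisj).symm
    _ ≤ _ := by
        refine card_le_card fun z hz => ?_
        rw [mem_biUnion] at hz
        obtain ⟨n, -, hn⟩ := hz
        rw [mem_product, mem_filter, mem_filter] at hn
        exact mem_filter.2 ⟨mem_product.2 ⟨hn.1.1, hn.2.1⟩, hn.1.2.trans hn.2.2.symm⟩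

/-! ### Pintz–Ruzsa I (10.3) and the reduction of `goldbach_linnik` to the mean square -/

/-- **Pintz–Ruzsa I (10.3)** (Parseval, dropping the terms `m > N`):
`∑_{n < N, 2∤n} r'_k(n)² ≤ ∫₀¹ |S(α) G(α)^k|² dα`. [cite: PintzRuzsa2003, (10.3)] -/
theorem secondMoment_le_integral (N k : ℕ) :
    (secondMoment N k : ℝ) ≤ ∫ α in (0 : ℝ)..1, ‖primeSum N α * powSum N α ^ k‖ ^ 2 := by
  simp_rw [primeSum_mul_powSum_pow]
  rw [integral_norm_sq_expSum]
  exact_mod_cast sum_card_fiber_sq_le (oddPrimes N ×ˢ expTuples N k)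
    (fun x => x.1 + ∑ i, 2 ^ x.2 i) (oddBelow N)

/-- **Pintz–Ruzsa, K = 8, modulo the mean-square estimate (Lemma 13 as proved, `k = 4`).**
If `0 ≤ B < 1` and for every `ε > 0` and all large `N`
`∫₀¹ |S(α) G(α)⁴|² dα ≤ (1 + B + ε) · 2 N L⁸ / log² N` (Pintz–Ruzsa I (10.3)–(10.6) give this
with `B = A(4) + C₂'(1-η)⁶` under GRH; Part II unconditionally with `B = A(4) + C₂'λ⁶ < 1`,
`λ = 0.7894…`), then every sufficiently large even `N` is a sum of two primes and at most `8`
powers of two. [cite: PintzRuzsa2003, Lemma 13 and §10] -/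
theorem goldbach_linnik_of_meanSquare_four {B : ℝ} (hB0 : 0 ≤ B) (hB1 : B < 1)
    (hI : ∀ ε : ℝ, 0 < ε → ∀ᶠ N : ℕ in atTop,
      ∫ α in (0 : ℝ)..1, ‖primeSum N α * powSum N α ^ 4‖ ^ 2 ≤ (1 + B + ε) * secondMain N 4) :
    goldbach_linnik :=
  goldbach_linnik_of_secondMoment_four hB0 hB1 fun ε hε =>
    (hI ε hε).mono fun N h => (secondMoment_le_integral N 4).trans h

end GoldbachLinnik

end Literature.NumberTheory.Sieve
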